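import Summits.QuantumFields.BalabanUV.T4Continuum.Spine.NE1p.TiltedMeanInfluence
import Summits.QuantumFields.BalabanUV.T4Continuum.Spine.NE7.Targets
import Summits.QuantumFields.YangMills.Theorems.BalabanUVNodesN20HybridClassLawCharacterisation

/-!
# DAG node N14 (NE1′) → N19′ ∕ N20 — THE TARGET CONJUNCT IS NODE N14's BINDER, CLASS-AVERAGED: law of total tilted expectation along the
# class partition; `MatchingModConstants` ∕ `NE7.Target` ⇐ `TiltedMeanMatching` + bad weight + class-law TV; with dag-n20-w4's characterisation
# ⇒ the `∃`-hybrid WITHOUT a core ∕ mass ∕ variance letter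

Cell `pub-ymgap` (HUMAN RULING D-0062, Track A), WIDTH SEAT `pub-ymgap-dag-n14-w2` (NODE n14 = NE1′), generation 6; `--kind proof --supports
stmt-QuantumFields-20544 --as helper` (K3⁷; helper, NOT a discharge; count-neutral).  THEOREMS ONLY (0 `def`, 0 `instance`, 0 `sorry`).  Imports the NE1′
lineage's `Spine.NE1p.TiltedMeanInfluence` (`tiltedMean_eq_div`, `abs_tiltedMean_le`, `integrable_mul_exp_mul`; through it `DressedMGFForm`: `tiltedMean`,
`MGFForm`, `TiltedMeanMatching`, `deriv_cgf_eq_tiltedMean`, `abs_cgf_sub_sub_le`), `Spine.NE7.Targets` (`Target`, `target_of_hybridNE7`) and dag-n20-w4's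
`…N20HybridClassLawCharacterisation` (p609004: `exists_hybridNE7_of_target_of_classLawTV`, `exists_tvRadius_of_hybridNE7`) — CITED BY NAME; edits nothing.

WHY.  dag-n20-w4's characterisation reads, at one key: `(∃ six dials, HybridNE7) ⟺ NE7.Target ∧ (summable per-set class-law TV radius < 1)`; the
TARGET is a SEPARATE conjunct no class-law statement gives.  The crux cards (idea-3 `hellinger-free-energy-road`, K2 «(R) RESPONSE LETTER … the genuinely
new part is the mass-averaged FIRST moment ⟨∂_t h_t⟩») and the abstract calculus files claimed for them (dag-n20-w4 g2, dag-n19-w4 g4) treat that first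
moment as a NEW hypothesis letter.  In the MGF FORM the consumer reads (`A K t τ = mgf (F K) (ν K τ) t`, run B summed into run A's classes) it is NOT
new: `∂_t log A_t(τ) = tiltedMean (F K) (ν K τ) t` is N14's TILTED MEAN (so the «susceptibility» letter is free, `|·| ≤ B`), `∂_t h_t(τ)` is EXACTLY
what N14's residual binder `TiltedMeanMatching` bounds class by class, and (law of total tilted expectation, §1–§2)
  `∂_t (log Z_B − log Z_A)(t) = Σ_τ p_t(τ)·(m′_t − m_t)(τ) + Σ_τ (q_t − p_t)(τ)·m′_t(τ)`
(`p_t, q_t` the dressed CLASS LAWS, `m, m′` the class-wise tilted means): the first sum is N14's binder AVERAGED under run A's class law (good classes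
`≤ η_K`, bad classes cost `2B·W_K`), the second is `≤ 2B ×` the class-law TV radius `ρ_K` every hybrid pays (p607565).  Hence (§3) `Target` ⇐
`TiltedMeanMatching η` + NE7b's bad weight + class-law TV with `vol·δ_K = l₀(η_K + 2B(W_K + ρ_K))`, NO core ∕ mass ∕ variance ∕ covariance letter, and
by dag-n20-w4's sufficiency theorem the `∃`-hybrid follows from the TV letter AND N14's binder alone; §4 (two-sidedness): ANY six dials pin the
class-averaged N14 mismatch to within `2B·ρ_K` of `∂_s(log Z_{K+1} − log Z_K)`, itself pinned to a constant within `vol·δ′_K` on the window.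

HONEST FRAMING.  [folklore] law of total expectation for exponentially tilted finite measures + finite-sum bookkeeping on hypothesis SHAPES; N14's
binder, the bad weight `W` and the class-law TV radius `ρ` are HYPOTHESES produced by nobody (no live Stage-13 tuple exhibited, K0⁷ OPEN); proves NO
estimate of the programme; nothing of Bałaban's asserted or instantiated; NE1′ ∕ NE7 ∕ NE7b NOT PRINTED as two-run statements for d = 4, NOT proved;
N14 ∕ N19 ∕ N20 NOT discharged; K3⁷ OPEN, skeleton v5 untouched; counts UNMOVED.  One finite 𝕋⁴ programme at fixed ε; R4 closes only the CONDITIONAL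
finite-𝕋⁴ rung `BalabanLadder.UV` — NOT ℝ⁴, NOT OS, NOT the Yang–Mills mass gap (Clay), which is NOT proved by any of this.
-/

noncomputable section

open MeasureTheory ProbabilityTheory Finset

namespace YMDAG.N14.TargetOfBinderAndClassLawTV

open Literature.MathematicalPhysics.QuantumFieldTheory.Balaban1983to89
open Literature.MathematicalPhysics.QuantumFieldTheory.Balaban1983to89.T4CauchySum (MatchingModConstants)
open Literature.MathematicalPhysics.QuantumFieldTheory.Balaban1983to89.T4MatchingAssembly (HybridNE7)
open Literature.MathematicalPhysics.QuantumFieldTheory.Balaban1983to89.T4WeightBudget (RelWeightBound)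
open Summit.QuantumFields.BalabanUV.T4Continuum.NE1p.DressedMGFForm
open Summit.QuantumFields.BalabanUV.T4Continuum.NE1p.TiltedMeanInfluence (tiltedMean_eq_div abs_tiltedMean_le integrable_mul_exp_mul)
open Summit.QuantumFields.BalabanUV.T4Continuum.Spine.NE7 (Target target_of_hybridNE7)
open Summit.QuantumFields.YangMills.BalabanUVNodes.N20HybridClassLawCharacterisation
  (exists_hybridNE7_of_target_of_classLawTV exists_tvRadius_of_hybridNE7)

/-! ## §1 One family of class pieces: the law of total tilted expectation along the class partition -/

section OneFamily

variable {Ω : Type*} {mΩ : MeasurableSpace Ω} {ι : Type*} {F : Ω → ℝ} {B : ℝ}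

/-- ONE PIECE: the tilted-mean numerator is the MGF times the tilted mean, `∫ F·e^{sF} dν = mgf F ν s · tiltedMean F ν s`
(finite `ν`, `|F| ≤ B` measurable; both sides `0` for `ν = 0`). [folklore] -/
theorem integral_mul_exp_eq_mgf_mul_tiltedMean (ν : Measure Ω) [IsFiniteMeasure ν] (hFm : Measurable F) (hF : ∀ ω, |F ω| ≤ B)
    (s : ℝ) : ∫ ω, F ω * Real.exp (s * F ω) ∂ν = mgf F ν s * tiltedMean F ν s := by
  rcases eq_zero_or_neZero ν with rfl | hν
  · simp only [integral_zero_measure, mgf_zero_measure, Pi.zero_apply, zero_mul]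
  have hpos : 0 < mgf F ν s := T4GenFunBounds.mgf_pos_of_abs_le hFm.aemeasurable (ae_of_all _ hF) s
  rw [tiltedMean_eq_div]
  exact (mul_div_cancel₀ _ hpos.ne').symm

/-- A finite sum of finite measures is finite. [folklore] -/
theorem isFiniteMeasure_finsetSum (T : Finset ι) (ν : ι → Measure Ω) (hfin : ∀ τ ∈ T, IsFiniteMeasure (ν τ)) :
    IsFiniteMeasure (∑ τ ∈ T, ν τ) :=
  ⟨by rw [Measure.finsetSum_apply]; exact ENNReal.sum_lt_top.mpr fun τ hτ => by haveI := hfin τ hτ; exact measure_lt_top _ _⟩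

/-- The MGF under the summed measure is the sum of the MGFs (the whole dressed partition function is the sum of the dressed class
totals: `Z_A(s) = Σ_τ A_s(τ)`). [folklore] -/
theorem mgf_finsetSum_measure (T : Finset ι) (ν : ι → Measure Ω) (hfin : ∀ τ ∈ T, IsFiniteMeasure (ν τ)) (hFm : Measurable F)
    (hF : ∀ ω, |F ω| ≤ B) (s : ℝ) : mgf F (∑ τ ∈ T, ν τ) s = ∑ τ ∈ T, mgf F (ν τ) s := by
  simp only [mgf]
  exact integral_finsetSum_measure fun τ hτ => by
    haveI := hfin τ hτ
    exact T4GenFunBounds.integrable_exp_mul_of_bound hFm.aemeasurable (ae_of_all _ hF) s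

/-- ★ **LAW OF TOTAL TILTED EXPECTATION** (product form, no division): for class pieces `ν τ` (`τ ∈ T`, finite) of one measure and one
bounded observable `F`, `mgf F (Σ_T ν) s · tiltedMean F (Σ_T ν) s = Σ_T mgf F (ν τ) s · tiltedMean F (ν τ) s` — the source-tilted mean of
the WHOLE measure is the average of the class-wise tilted means weighted by the DRESSED class totals `mgf F (ν τ) s = A_s(τ)`. [folklore] -/
theorem mgf_mul_tiltedMean_finsetSum_measure (T : Finset ι) (ν : ι → Measure Ω) (hfin : ∀ τ ∈ T, IsFiniteMeasure (ν τ))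
    (hFm : Measurable F) (hF : ∀ ω, |F ω| ≤ B) (s : ℝ) :
    mgf F (∑ τ ∈ T, ν τ) s * tiltedMean F (∑ τ ∈ T, ν τ) s = ∑ τ ∈ T, mgf F (ν τ) s * tiltedMean F (ν τ) s := by
  haveI := isFiniteMeasure_finsetSum T ν hfin
  rw [← integral_mul_exp_eq_mgf_mul_tiltedMean _ hFm hF s]
  rw [integral_finsetSum_measure fun τ hτ => by haveI := hfin τ hτ; exact integrable_mul_exp_mul (ρ := ν τ) hFm hF s]
  exact Finset.sum_congr rfl fun τ hτ => by
    haveI := hfin τ hτ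
    exact integral_mul_exp_eq_mgf_mul_tiltedMean _ hFm hF s

/-- Quotient form: when the whole dressed total is positive, `tiltedMean F (Σ_T ν) s = Σ_T (A_s(τ)∕Z_A(s))·tiltedMean F (ν τ) s` with
`A_s(τ) = mgf F (ν τ) s`, `Z_A(s) = Σ_T A_s(τ)` — the whole tilted mean is the mean of the class tilted means under run A's dressed CLASS LAW
`p_s`. [folklore] -/
theorem tiltedMean_finsetSum_measure (T : Finset ι) (ν : ι → Measure Ω) (hfin : ∀ τ ∈ T, IsFiniteMeasure (ν τ)) (hFm : Measurable F)
    (hF : ∀ ω, |F ω| ≤ B) (s : ℝ) (hZ : 0 < ∑ τ ∈ T, mgf F (ν τ) s) :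
    tiltedMean F (∑ τ ∈ T, ν τ) s = ∑ τ ∈ T, mgf F (ν τ) s / (∑ σ ∈ T, mgf F (ν σ) s) * tiltedMean F (ν τ) s := by
  have h := mgf_mul_tiltedMean_finsetSum_measure T ν hfin hFm hF s
  rw [mgf_finsetSum_measure T ν hfin hFm hF s] at h
  have h' : tiltedMean F (∑ τ ∈ T, ν τ) s
      = (∑ τ ∈ T, mgf F (ν τ) s * tiltedMean F (ν τ) s) / ∑ σ ∈ T, mgf F (ν σ) s := by
    rw [eq_div_iff hZ.ne', mul_comm]; exact h
  rw [h', Finset.sum_div]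
  exact Finset.sum_congr rfl fun τ _ => by ring

end OneFamily

/-! ## §2 Two runs on one class index: pure finite sums -/

section TwoRuns

variable {ι : Type*} {T Bad : Finset ι} {a b m m' : ι → ℝ} {B η W ρ : ℝ}

/-- The two-run split of the whole means: `Σq·m′ − Σp·m = Σp·(m′ − m) + Σ(q − p)·m′` with `p = a∕Σa`, `q = b∕Σb`. [folklore] -/
theorem avg_sub_avg_eq_split (T : Finset ι) (a b m m' : ι → ℝ) :
    (∑ τ ∈ T, b τ / (∑ σ ∈ T, b σ) * m' τ) - ∑ τ ∈ T, a τ / (∑ σ ∈ T, a σ) * m τ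
      = (∑ τ ∈ T, a τ / (∑ σ ∈ T, a σ) * (m' τ - m τ))
        + ∑ τ ∈ T, (b τ / (∑ σ ∈ T, b σ) - a τ / (∑ σ ∈ T, a σ)) * m' τ := by
  rw [← Finset.sum_sub_distrib, ← Finset.sum_add_distrib]
  exact Finset.sum_congr rfl fun τ _ => by ring

/-- Per-set total variation controls the ℓ¹ distance: `|Σ_S p − Σ_S q| ≤ ρ` for every `S ⊆ T` gives `Σ_T |q − p| ≤ 2ρ` (split `T` at the
sign of `q − p`). [folklore] -/
theorem sum_abs_sub_le_two_mul_of_forall_subset [DecidableEq ι] (T : Finset ι) (p q : ι → ℝ)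
    (h : ∀ S ⊆ T, |∑ τ ∈ S, p τ - ∑ τ ∈ S, q τ| ≤ ρ) : ∑ τ ∈ T, |q τ - p τ| ≤ 2 * ρ := by
  set S₁ := T.filter fun τ => p τ ≤ q τ with hS₁
  set S₂ := T.filter fun τ => ¬ p τ ≤ q τ with hS₂
  have h1 : ∑ τ ∈ S₁, |q τ - p τ| = ∑ τ ∈ S₁, q τ - ∑ τ ∈ S₁, p τ := by
    rw [← Finset.sum_sub_distrib]
    exact Finset.sum_congr rfl fun τ hτ => abs_of_nonneg (sub_nonneg.mpr (Finset.mem_filter.mp hτ).2)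
  have h2 : ∑ τ ∈ S₂, |q τ - p τ| = ∑ τ ∈ S₂, p τ - ∑ τ ∈ S₂, q τ := by
    rw [← Finset.sum_sub_distrib]
    exact Finset.sum_congr rfl fun τ hτ => by
      rw [abs_sub_comm]; exact abs_of_pos (sub_pos.mpr (lt_of_not_ge (Finset.mem_filter.mp hτ).2))
  have hb1 := h S₁ (Finset.filter_subset _ _)
  have hb2 := h S₂ (Finset.filter_subset _ _)
  rw [← Finset.sum_filter_add_sum_filter_not T (fun τ => p τ ≤ q τ), ← hS₁, ← hS₂, h1, h2]
  linarith [neg_abs_le (∑ τ ∈ S₁, p τ - ∑ τ ∈ S₁, q τ), le_abs_self (∑ τ ∈ S₂, p τ - ∑ τ ∈ S₂, q τ)]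

/-- **THE TRANSPORT TERM** costs the observable bound times twice dag-n20-w4's per-set class-law TV radius:
`|Σ_T (q − p)·m′| ≤ 2B·ρ` for `p = a∕Σa`, `q = b∕Σb`, `|m′| ≤ B`. [folklore] -/
theorem abs_transport_le [DecidableEq ι] (T : Finset ι) (a b m' : ι → ℝ) (hB : 0 ≤ B) (hm : ∀ τ ∈ T, |m' τ| ≤ B)
    (hρ : ∀ S ⊆ T, |(∑ τ ∈ S, a τ) / (∑ τ ∈ T, a τ) - (∑ τ ∈ S, b τ) / (∑ τ ∈ T, b τ)| ≤ ρ) :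
    |∑ τ ∈ T, (b τ / (∑ σ ∈ T, b σ) - a τ / (∑ σ ∈ T, a σ)) * m' τ| ≤ 2 * B * ρ := by
  have hl1 : ∑ τ ∈ T, |b τ / (∑ σ ∈ T, b σ) - a τ / (∑ σ ∈ T, a σ)| ≤ 2 * ρ :=
    sum_abs_sub_le_two_mul_of_forall_subset T (fun τ => a τ / ∑ σ ∈ T, a σ) (fun τ => b τ / ∑ σ ∈ T, b σ) fun S hS => by
      simpa only [Finset.sum_div] using hρ S hS
  calc |∑ τ ∈ T, (b τ / (∑ σ ∈ T, b σ) - a τ / (∑ σ ∈ T, a σ)) * m' τ|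
      ≤ ∑ τ ∈ T, |(b τ / (∑ σ ∈ T, b σ) - a τ / (∑ σ ∈ T, a σ)) * m' τ| := Finset.abs_sum_le_sum_abs _ _
    _ ≤ ∑ τ ∈ T, |b τ / (∑ σ ∈ T, b σ) - a τ / (∑ σ ∈ T, a σ)| * B := Finset.sum_le_sum fun τ hτ => by
        rw [abs_mul]; exact mul_le_mul_of_nonneg_left (hm τ hτ) (abs_nonneg _)
    _ ≤ 2 * ρ * B := by rw [← Finset.sum_mul]; exact mul_le_mul_of_nonneg_right hl1 hB
    _ = 2 * B * ρ := by ring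

/-- The class-averaged N14 mismatch: on the good classes the class-wise tilted means agree within `η`, a bad class costs `2B` times its
relative weight — `|Σ_T p·(m′ − m)| ≤ η + 2B·W` for a class law `p = a∕Σa` (`a ≥ 0`, `Σa > 0`) with `Σ_Bad a ≤ W·Σ_T a`. [folklore] -/
theorem abs_avg_sub_le_of_good_bad [DecidableEq ι] (hBad : Bad ⊆ T) (ha : ∀ τ ∈ T, 0 ≤ a τ) (hZ : 0 < ∑ τ ∈ T, a τ)
    (hW : ∑ τ ∈ Bad, a τ ≤ W * ∑ τ ∈ T, a τ) (hB : 0 ≤ B) (hη : 0 ≤ η) (hm : ∀ τ ∈ T, |m τ| ≤ B) (hm' : ∀ τ ∈ T, |m' τ| ≤ B)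
    (hgood : ∀ τ ∈ T \ Bad, |m' τ - m τ| ≤ η) :
    |∑ τ ∈ T, a τ / (∑ σ ∈ T, a σ) * (m' τ - m τ)| ≤ η + 2 * B * W := by
  set Z := ∑ σ ∈ T, a σ with hZdef
  have hp : ∀ τ ∈ T, 0 ≤ a τ / Z := fun τ hτ => div_nonneg (ha τ hτ) hZ.le
  have hsplit : ∑ τ ∈ T, a τ / Z * (m' τ - m τ)
      = (∑ τ ∈ T \ Bad, a τ / Z * (m' τ - m τ)) + ∑ τ ∈ Bad, a τ / Z * (m' τ - m τ) := by
    rw [← Finset.sum_sdiff hBad]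
  have hgood' : |∑ τ ∈ T \ Bad, a τ / Z * (m' τ - m τ)| ≤ η := by
    calc |∑ τ ∈ T \ Bad, a τ / Z * (m' τ - m τ)| ≤ ∑ τ ∈ T \ Bad, |a τ / Z * (m' τ - m τ)| := Finset.abs_sum_le_sum_abs _ _
      _ ≤ ∑ τ ∈ T \ Bad, a τ / Z * η := Finset.sum_le_sum fun τ hτ => by
          rw [abs_mul, abs_of_nonneg (hp τ (Finset.sdiff_subset hτ))]
          exact mul_le_mul_of_nonneg_left (hgood τ hτ) (hp τ (Finset.sdiff_subset hτ))
      _ = (∑ τ ∈ T \ Bad, a τ / Z) * η := by rw [Finset.sum_mul]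
      _ ≤ (∑ τ ∈ T, a τ / Z) * η :=
          mul_le_mul_of_nonneg_right (Finset.sum_le_sum_of_subset_of_nonneg Finset.sdiff_subset fun τ hτ _ => hp τ hτ) hη
      _ = η := by rw [← Finset.sum_div, div_self hZ.ne', one_mul]
  have hbad' : |∑ τ ∈ Bad, a τ / Z * (m' τ - m τ)| ≤ 2 * B * W := by
    calc |∑ τ ∈ Bad, a τ / Z * (m' τ - m τ)| ≤ ∑ τ ∈ Bad, |a τ / Z * (m' τ - m τ)| := Finset.abs_sum_le_sum_abs _ _
      _ ≤ ∑ τ ∈ Bad, a τ / Z * (2 * B) := Finset.sum_le_sum fun τ hτ => by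
          have hτT := hBad hτ
          rw [abs_mul, abs_of_nonneg (hp τ hτT)]
          refine mul_le_mul_of_nonneg_left ?_ (hp τ hτT)
          calc |m' τ - m τ| ≤ |m' τ| + |m τ| := abs_sub _ _
            _ ≤ B + B := add_le_add (hm' τ hτT) (hm τ hτT)
            _ = 2 * B := by ring
      _ = (∑ τ ∈ Bad, a τ) / Z * (2 * B) := by rw [← Finset.sum_mul, Finset.sum_div]
      _ ≤ W * (2 * B) := by
          refine mul_le_mul_of_nonneg_right ?_ (by positivity)
          rw [div_le_iff₀ hZ]; exact hW
      _ = 2 * B * W := by ring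
  rw [hsplit]
  exact (abs_add_le _ _).trans (add_le_add hgood' hbad')

/-- ★ **THE WHOLE TILTED MEANS OF THE TWO RUNS DIFFER BY AT MOST `η + 2B·W + 2B·ρ`**: `M = Σ_T p·m`, `M′ = Σ_T q·m′` the class-law averages of
class-wise tilted means bounded by `B`; N14's class-wise matching `η` on the good classes, bad weight `W` under run A's class law, per-set
class-law TV `ρ`. [folklore] -/
theorem abs_avg_sub_avg_le [DecidableEq ι] (hBad : Bad ⊆ T) (ha : ∀ τ ∈ T, 0 ≤ a τ) (hZa : 0 < ∑ τ ∈ T, a τ)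
    (hW : ∑ τ ∈ Bad, a τ ≤ W * ∑ τ ∈ T, a τ) (hB : 0 ≤ B) (hη : 0 ≤ η) (hm : ∀ τ ∈ T, |m τ| ≤ B) (hm' : ∀ τ ∈ T, |m' τ| ≤ B)
    (hgood : ∀ τ ∈ T \ Bad, |m' τ - m τ| ≤ η)
    (hρ : ∀ S ⊆ T, |(∑ τ ∈ S, a τ) / (∑ τ ∈ T, a τ) - (∑ τ ∈ S, b τ) / (∑ τ ∈ T, b τ)| ≤ ρ) :
    |(∑ τ ∈ T, b τ / (∑ σ ∈ T, b σ) * m' τ) - ∑ τ ∈ T, a τ / (∑ σ ∈ T, a σ) * m τ| ≤ η + 2 * B * W + 2 * B * ρ := by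
  rw [avg_sub_avg_eq_split]
  exact (abs_add_le _ _).trans
    (add_le_add (abs_avg_sub_le_of_good_bad hBad ha hZa hW hB hη hm hm' hgood) (abs_transport_le T a b m' hB hm' hρ))

end TwoRuns

/-! ## §3 At the MGF forms: the whole tilted means, `MatchingModConstants`, `Target`, and the `∃`-hybrid via dag-n20-w4 -/

section AtForms

variable {ι : Type*} {Ω Ω' : ℕ → Type*} [∀ K, MeasurableSpace (Ω K)] [∀ K, MeasurableSpace (Ω' K)]
  {l₀ vol B : ℝ} {T : ℕ → Finset ι} {Bad : ℕ → ℝ → Finset ι}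
  {F : ∀ K, Ω K → ℝ} {ν : ∀ K, ι → Measure (Ω K)} {F' : ∀ K, Ω' K → ℝ} {ν' : ∀ K, ι → Measure (Ω' K)}
  {A Bf : ℕ → ℝ → ι → ℝ} {η W ρ δ : ℕ → ℝ} {Z : ℕ → ℝ → ℝ}

/-- In MGF form the whole dressed partition function of run A at level `K` is the MGF of the observable under the SUM of the class
pieces: `Σ_{T K} A K s τ = mgf (F K) (Σ_{T K} ν K τ) s`. [folklore] -/
theorem sum_eq_mgf_finsetSum (hA : MGFForm B T F ν A) (K : ℕ) (s : ℝ) :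
    ∑ τ ∈ T K, A K s τ = mgf (F K) (∑ τ ∈ T K, ν K τ) s := by
  rw [mgf_finsetSum_measure (T K) (ν K) (hA.finite K) (hA.meas K) (hA.bound K) s]
  exact Finset.sum_congr rfl fun τ hτ => hA.repr K s τ hτ

/-- In MGF form the WHOLE source-tilted mean of run A at level `K` is the average of N14's class-wise tilted means under run A's
dressed class law `p_s(τ) = A K s τ ∕ Σ_T A K s`. [folklore] -/
theorem tiltedMean_total_eq_avg (hA : MGFForm B T F ν A) (K : ℕ) {s : ℝ} (hZ : 0 < ∑ τ ∈ T K, A K s τ) :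
    tiltedMean (F K) (∑ τ ∈ T K, ν K τ) s
      = ∑ τ ∈ T K, A K s τ / (∑ σ ∈ T K, A K s σ) * tiltedMean (F K) (ν K τ) s := by
  have hr : ∀ τ ∈ T K, mgf (F K) (ν K τ) s = A K s τ := fun τ hτ => (hA.repr K s τ hτ).symm
  have hsum : ∑ σ ∈ T K, mgf (F K) (ν K σ) s = ∑ σ ∈ T K, A K s σ := Finset.sum_congr rfl hr
  have hZ' : 0 < ∑ σ ∈ T K, mgf (F K) (ν K σ) s := hsum ▸ hZ
  rw [tiltedMean_finsetSum_measure (T K) (ν K) (hA.finite K) (hA.meas K) (hA.bound K) s hZ', hsum]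
  exact Finset.sum_congr rfl fun τ hτ => by rw [hr τ hτ]

/-- On the source window the log of the whole dressed partition function is the cumulant generating function of the observable under the
summed class pieces (dictionary `Z K s = Σ_T A K s τ`). [folklore] -/
theorem log_eq_cgf_finsetSum (hA : MGFForm B T F ν A) (hZA' : ∀ (K : ℕ) (t : ℝ), |t| ≤ l₀ → Z K t = ∑ τ ∈ T K, A K t τ)
    (K : ℕ) {s : ℝ} (hs : |s| ≤ l₀) : Real.log (Z K s) = cgf (F K) (∑ τ ∈ T K, ν K τ) s := by
  rw [hZA' K s hs, sum_eq_mgf_finsetSum hA K s, cgf]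

variable [DecidableEq ι]
  (hA : MGFForm B T F ν A) (hB : MGFForm B T F' ν' Bf) (hη : TiltedMeanMatching l₀ T Bad F ν F' ν' η) (hη0 : ∀ K, 0 ≤ η K)
  (hBadT : ∀ (K : ℕ) (t : ℝ), |t| ≤ l₀ → Bad K t ⊆ T K)
  (hW : ∀ (K : ℕ) (t : ℝ), |t| ≤ l₀ → ∑ τ ∈ Bad K t, A K t τ ≤ W K * ∑ τ ∈ T K, A K t τ)
  (hρ : ∀ (K : ℕ) (t : ℝ), |t| ≤ l₀ → ∀ S ⊆ T K,
    |(∑ τ ∈ S, A K t τ) / (∑ τ ∈ T K, A K t τ) - (∑ τ ∈ S, Bf K t τ) / (∑ τ ∈ T K, Bf K t τ)| ≤ ρ K)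
  (hZA : ∀ (K : ℕ) (t : ℝ), |t| ≤ l₀ → 0 < ∑ τ ∈ T K, A K t τ) (hZB : ∀ (K : ℕ) (t : ℝ), |t| ≤ l₀ → 0 < ∑ τ ∈ T K, Bf K t τ)

include hA hB hη hη0 hBadT hW hρ hZA hZB

/-- ★★ **THE WHOLE TILTED MEANS OF THE TWO RUNS AGREE WITHIN `η_K + 2B·W_K + 2B·ρ_K`** at every source `|s| ≤ l₀`, from (the shared binders of
this section): the two MGF forms `hA`, `hB` (run B summed into run A's classes `T K`), N14's residual binder `hη : TiltedMeanMatching l₀ T Bad F ν F′ ν′ η`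
(class-wise, good classes; `0 ≤ η`), the bad-class relative weight `hW : Σ_{Bad K s} A K s ≤ W K·Σ_{T K} A K s` under run A's DRESSED class law (the text
of `RelWeightBound.bad_left`, `hBadT : Bad ⊆ T`), dag-n20-w4's per-set class-law TV letter `hρ` VERBATIM, positivity of the totals `hZA`, `hZB`.
No core ∕ mass ∕ variance ∕ susceptibility letter. [folklore] -/
theorem abs_tiltedMean_total_sub_total_le (K : ℕ) {s : ℝ} (hs : |s| ≤ l₀) :
    |tiltedMean (F' K) (∑ τ ∈ T K, ν' K τ) s - tiltedMean (F K) (∑ τ ∈ T K, ν K τ) s| ≤ η K + 2 * B * W K + 2 * B * ρ K := by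
  rw [tiltedMean_total_eq_avg hB K (hZB K s hs), tiltedMean_total_eq_avg hA K (hZA K s hs)]
  exact abs_avg_sub_avg_le (hBadT K s hs) (fun τ hτ => hA.nonneg' K s hτ) (hZA K s hs) (hW K s hs) hA.nonneg (hη0 K)
    (fun τ _ => abs_tiltedMean_le (hA.bound K) hA.nonneg s) (fun τ _ => abs_tiltedMean_le (hB.bound K) hB.nonneg s)
    (fun τ hτ => hη K s hs τ hτ s hs) (hρ K s hs)

/-- ★★★ **NODE U5's OUTPUT SHAPE FROM N14's BINDER, THE BAD WEIGHT AND THE CLASS-LAW TV**: `T4CauchySum.MatchingModConstants vol l₀ δ Z` with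
`c_K = log Z_{K+1}(0) − log Z_K(0)` whenever `l₀·(η_K + 2B·W_K + 2B·ρ_K) ≤ vol·δ_K` — the mean value inequality for `s ↦ cgf_B(s) − cgf_A(s)`, whose
derivative is the difference of the whole tilted means (`DressedMGFForm.abs_cgf_sub_sub_le` BY NAME); dictionary `Z K = Σ_T A K`, `Z (K+1) = Σ_T Bf K` on
the window as in `HybridNE7.cauchy`. [folklore] -/
theorem matchingModConstants_of_binder_classLawTV (hZA' : ∀ (K : ℕ) (t : ℝ), |t| ≤ l₀ → Z K t = ∑ τ ∈ T K, A K t τ)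
    (hZB' : ∀ (K : ℕ) (t : ℝ), |t| ≤ l₀ → Z (K + 1) t = ∑ τ ∈ T K, Bf K t τ)
    (hw : ∀ K, l₀ * (η K + 2 * B * W K + 2 * B * ρ K) ≤ vol * δ K) : MatchingModConstants vol l₀ δ Z := by
  intro K
  set μA : Measure (Ω K) := ∑ τ ∈ T K, ν K τ
  set μB : Measure (Ω' K) := ∑ τ ∈ T K, ν' K τ
  haveI : IsFiniteMeasure μA := isFiniteMeasure_finsetSum (T K) (ν K) (hA.finite K)
  haveI : IsFiniteMeasure μB := isFiniteMeasure_finsetSum (T K) (ν' K) (hB.finite K)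
  refine ⟨cgf (F' K) μB 0 - cgf (F K) μA 0, fun t ht => ?_⟩
  have h0 : |(0 : ℝ)| ≤ l₀ := by rw [abs_zero]; exact (abs_nonneg t).trans ht
  have hrate : ∀ s, |s| ≤ l₀ → |tiltedMean (F' K) μB s - tiltedMean (F K) μA s| ≤ η K + 2 * B * W K + 2 * B * ρ K :=
    fun s hs => abs_tiltedMean_total_sub_total_le hA hB hη hη0 hBadT hW hρ hZA hZB K hs
  have hmv := abs_cgf_sub_sub_le (ν := μA) (ν' := μB) (hA.meas K) (hA.bound K) (hB.meas K) (hB.bound K) hrate ht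
  have hr0 : 0 ≤ η K + 2 * B * W K + 2 * B * ρ K := (abs_nonneg _).trans (hrate 0 h0)
  rw [log_eq_cgf_finsetSum hB hZB' K ht, log_eq_cgf_finsetSum hA hZA' K ht]
  calc |cgf (F' K) μB t - cgf (F K) μA t - (cgf (F' K) μB 0 - cgf (F K) μA 0)|
      = |(cgf (F' K) μB t - cgf (F' K) μB 0) - (cgf (F K) μA t - cgf (F K) μA 0)| := by ring_nf
    _ ≤ (η K + 2 * B * W K + 2 * B * ρ K) * |t| := hmv
    _ ≤ (η K + 2 * B * W K + 2 * B * ρ K) * l₀ := mul_le_mul_of_nonneg_left ht hr0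
    _ ≤ vol * δ K := by rw [mul_comm]; exact hw K

/-- ★★★ **NE7's TARGET FROM N14's BINDER, THE BAD WEIGHT AND THE CLASS-LAW TV** (`Spine.NE7.Target` = `MatchingModConstants ∧ Summable δ`), with the
explicit summable remainder `δ_K = l₀·(η_K + 2B·W_K + 2B·ρ_K)∕vol` (Σ η, Σ W, Σ ρ < ∞).  The TARGET conjunct of dag-n20-w4's
`exists_hybridNE7_iff_target_and_classLawTV` — the one «no class-law statement can give» — is node N14's binder in class-averaged form plus the
budgets every hybrid pays. [folklore] -/
theorem target_of_binder_classLawTV (hvol : 0 < vol) (hηs : Summable η) (hWs : Summable W) (hρs : Summable ρ)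
    (hZA' : ∀ (K : ℕ) (t : ℝ), |t| ≤ l₀ → Z K t = ∑ τ ∈ T K, A K t τ)
    (hZB' : ∀ (K : ℕ) (t : ℝ), |t| ≤ l₀ → Z (K + 1) t = ∑ τ ∈ T K, Bf K t τ) :
    Target vol l₀ (fun K => l₀ * (η K + 2 * B * W K + 2 * B * ρ K) / vol) Z := by
  refine ⟨matchingModConstants_of_binder_classLawTV hA hB hη hη0 hBadT hW hρ hZA hZB hZA' hZB' fun K => ?_, ?_⟩
  · rw [mul_div_cancel₀ _ hvol.ne']
  · exact (((hηs.add (hWs.mul_left (2 * B))).add (hρs.mul_left (2 * B))).mul_left l₀).div_const vol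

/-- ★★★ **THE `∃`-HYBRID AT A KEY FROM THE CLASS-LAW TV LETTER AND N14's BINDER ALONE** — dag-n20-w4's sufficiency theorem
`exists_hybridNE7_of_target_of_classLawTV` BY NAME, its Target conjunct discharged by `target_of_binder_classLawTV`: N14's `TiltedMeanMatching η`
(Σ η < ∞), a bad-class weight `W` under run A's dressed class law (Σ W < ∞), the per-set class-law TV radius `0 ≤ ρ_K < 1` (Σ ρ < ∞), positivity and
the dictionary ⟹ `∃ shA shB, HybridNE7 l₀ vol T A Bf ∅ 0 shA shB ρ δ` (`Bad = ∅`, `W = 0`, constructed shells, `δ_K = l₀(η_K + 2B·W_K + 2B·ρ_K)∕vol`) —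
NO core sandwich, NO mass ∕ variance ∕ susceptibility letter.  (This lineage's g3 class-law roads fed dag-n20-w4's slot with NE7-S_cl or MASS_cl ∧ TV_cl;
here TV_cl ∧ N14 ∧ NE7b-weight.) [folklore] -/
theorem exists_hybridNE7_of_binder_classLawTV (hl₀ : 0 ≤ l₀) (hvol : 0 < vol) (hηs : Summable η) (hWs : Summable W)
    (hρ0 : ∀ K, 0 ≤ ρ K) (hρ1 : ∀ K, ρ K < 1) (hρs : Summable ρ)
    (hZA' : ∀ (K : ℕ) (t : ℝ), |t| ≤ l₀ → Z K t = ∑ τ ∈ T K, A K t τ)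
    (hZB' : ∀ (K : ℕ) (t : ℝ), |t| ≤ l₀ → Z (K + 1) t = ∑ τ ∈ T K, Bf K t τ) :
    ∃ shA shB : ℕ → ℝ → ι → ℝ,
      HybridNE7 l₀ vol T A Bf (fun _ _ => ∅) (fun _ => 0) shA shB ρ (fun K => l₀ * (η K + 2 * B * W K + 2 * B * ρ K) / vol) :=
  exists_hybridNE7_of_target_of_classLawTV hl₀ (fun K t _ _ hτ => hA.nonneg' K t hτ) (fun K t _ _ hτ => hB.nonneg' K t hτ) hZA hZB
    hZA' hZB' (target_of_binder_classLawTV hA hB hη hη0 hBadT hW hρ hZA hZB hvol hηs hWs hρs hZA' hZB') hρ0 hρ1 hρs hρ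

omit hBadT hW in
/-- The same with the bad weight supplied BY NAME by NE7b's output shape `T4WeightBudget.RelWeightBound l₀ T A Bf Bad W` (only its run-A half,
`Bad ⊆ T` and `Σ W < ∞` are read). [folklore] -/
theorem exists_hybridNE7_of_binder_relWeightBound_classLawTV (hWb : RelWeightBound l₀ T A Bf Bad W) (hl₀ : 0 ≤ l₀) (hvol : 0 < vol)
    (hηs : Summable η) (hρ0 : ∀ K, 0 ≤ ρ K) (hρ1 : ∀ K, ρ K < 1) (hρs : Summable ρ)
    (hZA' : ∀ (K : ℕ) (t : ℝ), |t| ≤ l₀ → Z K t = ∑ τ ∈ T K, A K t τ)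
    (hZB' : ∀ (K : ℕ) (t : ℝ), |t| ≤ l₀ → Z (K + 1) t = ∑ τ ∈ T K, Bf K t τ) :
    ∃ shA shB : ℕ → ℝ → ι → ℝ,
      HybridNE7 l₀ vol T A Bf (fun _ _ => ∅) (fun _ => 0) shA shB ρ (fun K => l₀ * (η K + 2 * B * W K + 2 * B * ρ K) / vol) :=
  exists_hybridNE7_of_binder_classLawTV hA hB hη hη0 hWb.bad_subset hWb.bad_left hρ hZA hZB hl₀ hvol hηs hWb.summable hρ0 hρ1 hρs
    hZA' hZB'

end AtForms

/-! ## §4 Two-sidedness: the class-averaged N14 mismatch IS the source derivative of `log Z_B − log Z_A` up to the class-law transport term -/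

section TwoSided

variable {ι : Type*} {Ω Ω' : ℕ → Type*} [∀ K, MeasurableSpace (Ω K)] [∀ K, MeasurableSpace (Ω' K)]
  {l₀ vol B : ℝ} {T : ℕ → Finset ι}
  {F : ∀ K, Ω K → ℝ} {ν : ∀ K, ι → Measure (Ω K)} {F' : ∀ K, Ω' K → ℝ} {ν' : ∀ K, ι → Measure (Ω' K)}
  {A Bf : ℕ → ℝ → ι → ℝ} {Z : ℕ → ℝ → ℝ}

/-- The derivative of `s ↦ cgf_B(s) − cgf_A(s)` (the two runs' whole cumulant generating functions at level `K`) is the difference of the WHOLE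
tilted means (`DressedMGFForm.deriv_cgf_eq_tiltedMean` BY NAME). [folklore] -/
theorem deriv_cgf_sub_cgf_eq (hA : MGFForm B T F ν A) (hB : MGFForm B T F' ν' Bf) (K : ℕ) (s : ℝ) :
    deriv (fun s => cgf (F' K) (∑ τ ∈ T K, ν' K τ) s - cgf (F K) (∑ τ ∈ T K, ν K τ) s) s
      = tiltedMean (F' K) (∑ τ ∈ T K, ν' K τ) s - tiltedMean (F K) (∑ τ ∈ T K, ν K τ) s := by
  haveI : IsFiniteMeasure (∑ τ ∈ T K, ν K τ) := isFiniteMeasure_finsetSum (T K) (ν K) (hA.finite K)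
  haveI : IsFiniteMeasure (∑ τ ∈ T K, ν' K τ) := isFiniteMeasure_finsetSum (T K) (ν' K) (hB.finite K)
  have hdA := T4GenFunBounds.differentiable_cgf_of_abs_le (μ := ∑ τ ∈ T K, ν K τ) (hA.meas K).aemeasurable
    (ae_of_all _ (hA.bound K))
  have hdB := T4GenFunBounds.differentiable_cgf_of_abs_le (μ := ∑ τ ∈ T K, ν' K τ) (hB.meas K).aemeasurable
    (ae_of_all _ (hB.bound K))
  rw [deriv_fun_sub (hdB s) (hdA s), deriv_cgf_eq_tiltedMean (hB.meas K) (hB.bound K), deriv_cgf_eq_tiltedMean (hA.meas K) (hA.bound K)]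

/-- ★ **THE IDENTITY**: at every level `K` and source `s` with positive totals, N14's mismatch AVERAGED under run A's dressed class law,
`Σ_T p_s(τ)·(m′_s(τ) − m_s(τ))` (`m, m′` the class-wise tilted means of the two runs, `p_s = A K s∕Σ A K s`), EQUALS the source derivative
of `cgf_B − cgf_A` MINUS the class-law transport term `Σ_T (q_s − p_s)(τ)·m′_s(τ)` (`q_s = Bf K s∕Σ Bf K s`). [folklore] -/
theorem avgMismatch_eq_deriv_sub_transport (hA : MGFForm B T F ν A) (hB : MGFForm B T F' ν' Bf) (K : ℕ) {s : ℝ}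
    (hZA : 0 < ∑ τ ∈ T K, A K s τ) (hZB : 0 < ∑ τ ∈ T K, Bf K s τ) :
    ∑ τ ∈ T K, A K s τ / (∑ σ ∈ T K, A K s σ) * (tiltedMean (F' K) (ν' K τ) s - tiltedMean (F K) (ν K τ) s)
      = deriv (fun s => cgf (F' K) (∑ τ ∈ T K, ν' K τ) s - cgf (F K) (∑ τ ∈ T K, ν K τ) s) s
        - ∑ τ ∈ T K, (Bf K s τ / (∑ σ ∈ T K, Bf K s σ) - A K s τ / (∑ σ ∈ T K, A K s σ)) * tiltedMean (F' K) (ν' K τ) s := by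
  rw [deriv_cgf_sub_cgf_eq hA hB K s, tiltedMean_total_eq_avg hB K hZB, tiltedMean_total_eq_avg hA K hZA, avg_sub_avg_eq_split]
  ring

variable [DecidableEq ι]

/-- ★ **TWO-SIDEDNESS: ANY SIX DIALS PIN THE CLASS-AVERAGED N14 MISMATCH.**  If the two MGF-form runs carry a hybrid-NE7 datum
`HybridNE7 l₀ vol T A Bf Bad W shA shB Wsh δ` for SOME six dials (dictionary + positivity as in `HybridNE7.cauchy`), then there are summable
`ρ ≥ 0` and `δ′` with: the class-averaged N14 mismatch is within `2B·ρ_K` of the derivative of `s ↦ cgf_B(s) − cgf_A(s)` at every `|s| ≤ l₀`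
(dag-n20-w4 `exists_tvRadius_of_hybridNE7` BY NAME — the TV budget every hybrid pays, p607565), AND that function is `log Z_{K+1} − log Z_K`
on the window and is pinned to a constant within `vol·δ′_K` there (`target_of_hybridNE7` BY NAME).  Modulo the class-law TV budget the Target
conjunct IS the summable smallness of N14's binder in class-averaged (integrated) form. [folklore] -/
theorem avgMismatch_pinned_of_hybridNE7 {Bad : ℕ → ℝ → Finset ι} {W Wsh δ : ℕ → ℝ} {shA shB : ℕ → ℝ → ι → ℝ}
    (h : HybridNE7 l₀ vol T A Bf Bad W shA shB Wsh δ) (hvol : 0 < vol) (hl₀ : 0 ≤ l₀) (hA : MGFForm B T F ν A)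
    (hB : MGFForm B T F' ν' Bf) (hZA : ∀ (K : ℕ) (t : ℝ), |t| ≤ l₀ → 0 < ∑ τ ∈ T K, A K t τ)
    (hZB : ∀ (K : ℕ) (t : ℝ), |t| ≤ l₀ → 0 < ∑ τ ∈ T K, Bf K t τ)
    (hZA' : ∀ (K : ℕ) (t : ℝ), |t| ≤ l₀ → Z K t = ∑ τ ∈ T K, A K t τ)
    (hZB' : ∀ (K : ℕ) (t : ℝ), |t| ≤ l₀ → Z (K + 1) t = ∑ τ ∈ T K, Bf K t τ) :
    ∃ ρ δ' : ℕ → ℝ, (∀ K, 0 ≤ ρ K) ∧ Summable ρ ∧ Summable δ' ∧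
      (∀ K : ℕ, ∃ c : ℝ, ∀ s : ℝ, |s| ≤ l₀ →
        |(∑ τ ∈ T K, A K s τ / (∑ σ ∈ T K, A K s σ) * (tiltedMean (F' K) (ν' K τ) s - tiltedMean (F K) (ν K τ) s))
            - deriv (fun s => cgf (F' K) (∑ τ ∈ T K, ν' K τ) s - cgf (F K) (∑ τ ∈ T K, ν K τ) s) s| ≤ 2 * B * ρ K ∧
          cgf (F' K) (∑ τ ∈ T K, ν' K τ) s - cgf (F K) (∑ τ ∈ T K, ν K τ) s = Real.log (Z (K + 1) s) - Real.log (Z K s) ∧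
          |Real.log (Z (K + 1) s) - Real.log (Z K s) - c| ≤ vol * δ' K) := by
  obtain ⟨ρ, hρ01, hρs, hρ⟩ := exists_tvRadius_of_hybridNE7 h hZA hZB
  have hT := target_of_hybridNE7 h hvol hl₀ hZA' hZB' hZA
  refine ⟨ρ, _, fun K => (hρ01 K).1, hρs, hT.2, fun K => ?_⟩
  obtain ⟨c, hc⟩ := hT.1 K
  refine ⟨c, fun s hs => ⟨?_, ?_, hc s hs⟩⟩
  · rw [avgMismatch_eq_deriv_sub_transport hA hB K (hZA K s hs) (hZB K s hs), sub_sub_cancel_left, abs_neg]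
    exact abs_transport_le (T K) _ _ _ hB.nonneg (fun τ _ => abs_tiltedMean_le (hB.bound K) hB.nonneg s) (hρ K s hs)
  · rw [log_eq_cgf_finsetSum hB hZB' K hs, log_eq_cgf_finsetSum hA hZA' K hs]

end TwoSided

end YMDAG.N14.TargetOfBinderAndClassLawTV

end
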